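import Summits.HodgeConjecture.HodgeConjecture.Cruxes.BlochSeedDiscOne.DepthBoundA4

/-!
# CoverIntegralitySketch — pen holder's ELABORATION CHECK of the §E suggestions of `COVER-INTEGRALITY-JOINT.md` (negation g17)

Scratch for the typist (strengthen g11), not the node file `CoverIntegrality.lean` (single writer = strengthen). Statements over `DepthBoundA4`:
`CoverClosed` (L1 on a support pair; for a design it IS `Design.A4` read on `suppN ∕ suppP` — proved below, `coverClosed_of_A4`),
the two h = 6 letter facts F1 ∕ F2 used by the count law (stated over `Letter.OnAlphabet 6`; kernel route: FinCheck's `boxList`∕`upList` + `decide`, as `upList_six_le_nine`), and `CoverCountLaw6` (L1⁺, statement only).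
HONEST FRAMING: typed statements about the LETTER model; nothing here proves `FloorFree 6 199 8` ∕ `Nonex` ∕ 18881 ∕ H2 ∕ HC_AV ∕ HC_CM ∕ HC.
-/

set_option linter.dupNamespace false
set_option autoImplicit false

namespace Summit.HodgeConjecture.HodgeConjecture.Cruxes.BlochSeedDiscOne.CoverIntegralitySketch

open Summit.HodgeConjecture.HodgeConjecture.Cruxes.BlochSeedDiscOne.DepthBoundA4

/-- L1 COVER CLOSURE of a support pair `(SN, SP)`: every N cell has a P cell of the support slotwise amply below it (`Live c y`), and every
P cell has an N cell of the support above it. -/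
def CoverClosed (SN SP : Finset Cell) : Prop :=
  (∀ y ∈ SN, ∃ c ∈ SP, Live c y) ∧ (∀ c ∈ SP, ∃ y ∈ SN, Live c y)

/-- Soundness of L1: for a design, cover closure of the supports IS (A4). -/
theorem coverClosed_of_A4 (D : Design) (h : D.A4) : CoverClosed D.suppN.toFinset D.suppP.toFinset := by
  refine ⟨fun y hy => ?_, fun c hc => ?_⟩
  · obtain ⟨x, hx, hl⟩ := h.2 y (List.mem_toFinset.mp hy)
    exact ⟨x, List.mem_toFinset.mpr hx, hl⟩
  · obtain ⟨y, hy, hl⟩ := h.1 c (List.mem_toFinset.mp hc)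
    exact ⟨y, List.mem_toFinset.mpr hy, hl⟩

/-- and conversely, so the two are the same statement. -/
theorem A4_of_coverClosed (D : Design) (h : CoverClosed D.suppN.toFinset D.suppP.toFinset) : D.A4 := by
  refine ⟨fun x hx => ?_, fun y hy => ?_⟩
  · obtain ⟨y, hy, hl⟩ := h.2 x (List.mem_toFinset.mpr hx)
    exact ⟨y, List.mem_toFinset.mp hy, hl⟩
  · obtain ⟨c, hc, hl⟩ := h.1 y (List.mem_toFinset.mpr hy)
    exact ⟨c, List.mem_toFinset.mp hc, hl⟩

/-- a cell all of whose letters have height-coordinate `a = 2` («bottom⁴»); `abbrev` so that decidability is found by unfolding (no instances declared). -/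
abbrev Bottom4 (y : Cell) : Prop := ∀ f : Fin 4, (y f).a = 2
/-- a cell all of whose letters have `a = 0` («deep⁴»). -/
abbrev Deep4 (c : Cell) : Prop := ∀ f : Fin 4, (c f).a = 0

/-- F1 at h = 6: a letter amply below a letter with `a = 2` has `a = 0`. -/
def LetterFactF1 : Prop := ∀ ℓ ℓ' : Letter, ℓ.OnAlphabet 6 → ℓ'.OnAlphabet 6 → ℓ'.a = 2 → AmpleAbove ℓ ℓ' → ℓ.a = 0

/-- F2 at h = 6: a letter with `a = 0` is amply below at most one letter with `a = 2`. -/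
def LetterFactF2 : Prop :=
  ∀ ℓ y₁ y₂ : Letter, ℓ.OnAlphabet 6 → y₁.OnAlphabet 6 → y₂.OnAlphabet 6 → y₁.a = 2 → y₂.a = 2 → AmpleAbove ℓ y₁ → AmpleAbove ℓ y₂ → y₁ = y₂

/-- L1⁺ COVER COUNT LAW at h = 6 (statement): the number of distinct bottom⁴ N cells of an (A4) design on the height-6 alphabet is at most
its total deep⁴ P mass `D₄`. Proof route (memo B.3): (A4) gives each bottom⁴ N cell a live cover, F1 makes it deep⁴, F2 makes the cover
determine the cell, a present cell has mass ≥ 1. -/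
def CoverCountLaw6 : Prop :=
  ∀ D : Design, D.OnAlphabet 6 → D.A4 →
    ((D.suppN.filter fun y => Bottom4 y).toFinset.card : ℕ) ≤ ((D.P.filter fun cm => Deep4 cm.1).map Prod.snd).sum

/-- the node's umbrella statement as suggested in §E (v1): L1 on supports (which is (A4)) and the count law. -/
def CoverIntegralityLaw : Prop :=
  (∀ D : Design, D.A4 → CoverClosed D.suppN.toFinset D.suppP.toFinset) ∧ CoverCountLaw6

theorem coverIntegralityLaw_iff : CoverIntegralityLaw ↔ CoverCountLaw6 :=
  ⟨fun h => h.2, fun h => ⟨fun D hD => coverClosed_of_A4 D hD, h⟩⟩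

end Summit.HodgeConjecture.HodgeConjecture.Cruxes.BlochSeedDiscOne.CoverIntegralitySketch
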